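import Summits.QuantumFields.YangMills.Theorems.BalabanUVNodesN12GaugeLetterLocAtRecordLocal
import Literature.MathematicalPhysics.QuantumFieldTheory.Balaban1983to89.B15Prop1GaugeLetterTargetOfLinearBudgets

/-!
# (LOCAL EDITION — LOCATED-WJ repair: the datum letter `hWj` is asked only within walk-distance `ℓ_k + m′·L^k` of `Ω₁(Z)`, exactly what dag-n12-w3's LOCAL capstone
# `N12GaugeLetterLocAtRecordLocal.exists_gaugeLetterLoc_atRecord_local` (p656396) reads; everything else VERBATIM the global edition `N12GaugeLetterSocketAtRecord` p647369; typed by dag-n12-d g19 on the lane owner's word O2.)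
# BalabanUVNodes ∕ N12 — THE ∀δ∃e GAUGE-LETTER SOCKET OF THE ASSEMBLED ENDPOINTS FROM dag-n12-w3's FOREST-FREE ∕ `hT`-FREE CAPSTONE `exists_gaugeLetterLoc_atRecord`, WITH THE THREE
# DISPLAYED LETTERS (plaquette letter at the minimiser; iterated-average plaquette budgets `a`∕`θ`; datum letter at the members) READ LINEAR IN THE GUARD

Cell `pub-ymgap` (HUMAN RULINGS D-0062 ∕ D-0149 ∕ D-0154), WIDTH SEAT `pub-ymgap-dag-n12-w5` g5 (node N12 = [B15]; key K1⁹ `stmt-QuantumFields-27364`, `--kind proof --supports …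
--as helper`; count-neutral).  dag-n12-d's trigger (t92)∕«(vii)» one producer deeper (dag-n12-d g19, pub-ymgap INBOX 2026-08-28T14:39:05Z; dag-n12-w3 g4 INTENT-5, 14:33:40Z).  THEOREMS ONLY (0 `def`,
0 `instance`, 0 `sorry`); composition BY NAME of dag-n12-w3 g4's `N12GaugeLetterLocAtRecordLocal.exists_gaugeLetterLoc_atRecord_local`, dag-n12-w3's `N12RootTransporterBj.theta_mono_of_nonneg` and this
seat's `B15Prop1GaugeLetterTargetOfLinearBudgets.forall_target_exists_guard_of_linear` (p641043).  The Summits-side twin of `B15Prop1GaugeLetterSocketOfForestPackage` (p642885): the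
forest package, the budgets and the root-transporter letter are now INSIDE (dag-n12-w3's capstone), the displayed letters are gauge-invariant ∕ datum-side.

WHAT THIS FILE PROVES.  §1 ★ `hlin_of_gaugeLetterLocAtRecord_linear` — per instance (single-instance spelling): from the capstone's residual inputs VERBATIM (no-wrap `hN`, the `N`-geometry `hGN`
(at `𝒞 := boxBonds LO HI`) `hN1`, the LEVEL-FORM box letter `hSΩ`, the iterated-average plaquette budgets `a e`∕`θ e` with their numerics per guard `e`) and the three letters read LINEAR
IN THE GUARD over (guard `e ≤ e₀`, base field `V_k` in the guard with box datum `ρlin·e`, minimiser `U₀`): `hP : … → PlaqSmallOn S (cP·e) U₀`, `ha : … < a e j`, with a cap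
`θ e k ≤ cθ·e`, and `hWj : … ≤ cδ·e` ⟹ the `hlin` premise of `forall_target_exists_guard_of_linear` with `Cσ := ρlin + ((2ℓ_k+1+m·L^k)²∕4)·cP + m·cθ + m·cδ`.  §2 ★★
`hσN_of_gaugeLetterLocAtRecord_linear` — the ∀δ∃e `hσN` row of (iv)∕(v) as a theorem.

HONEST FRAMING.  Composition by name + real arithmetic; the plaquette letter at the minimiser ([15] Thm 1 ∕ (1.7)), the iterated-average plaquette letter, the datum letter and the
`N`-geometry stay HYPOTHESES (their linearity in the guard is the shape asked of the [15] door ∕ the datum normalisation, not proved here); per the lane owner's LOCATED-GEOM v3 the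
bondwise road serves instances with simply-connected, normalisable `Ω₁(Z)`; nothing of Bałaban's is asserted; count-neutral; N12 NOT discharged; K1⁹ NOT closed; counts unmoved; one
finite 𝕋⁴ programme at fixed `ε = L^{-K}` — R4 closes only the conditional rung `BalabanLadder.UV`; no summit statement is proved here and NOT the Yang–Mills mass gap (Clay); nothing
continuum ∕ ℝ⁴ ∕ OS.

References: [Balaban1985Variational] CMP 102 (1985) 277–309, (3)–(4) p.278, Thm 1 (8) p.279, (16)–(18) p.280; [Balaban1985RegularSpaces] CMP 98 (1985), (1.7) p.77, (1.19) p.79;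
[Balaban1988Convergent] CMP 119 (1988) 243–285, (2.2) p.255, (2.12)–(2.13) pp.256–257, (2.16) p.257; [Balaban1989LargeFieldI] CMP 122 (1989) 175–202, (1.74) p.192, Prop. 1 p.194.
-/

noncomputable section

open scoped Matrix.Norms.L2Operator BigOperators

namespace Summit.QuantumFields.YangMills.BalabanUVNodes.N12GaugeLetterSocketAtRecordLocal

open Literature.MathematicalPhysics.QuantumFieldTheory.Balaban1983to89
open T4Continuum GaugeField B15DeterminingSets BlockAveraging
open T4CubeChartGnomonic (SU2)
open B16Sect1Backgrounds (toMS)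
open T4AxialGaugeSmallField (boxPlaqs boxBonds)
open B14.Eq213MaximalDomains (side)
open B14.Eq213DetSet (Bj maxDomT)
open B14.Eq216Concrete (inputs)
open B14.Eq22Determines (blockIter)
open B5Eq118OneStroke (iterBlockOf)
open B15Prop1Carrier (plaqsInside)
open ExpMeanLog (deltaSU)
open Literature.MathematicalPhysics.QuantumFieldTheory.BalabanImbrieJaffe1984to88.BIJ85Eq453GaugeField (qsstarGIter0)
open B15Prop1GaugeLetterTargetOfLinearBudgets (forall_target_exists_guard_of_linear)
open Summit.QuantumFields.YangMills.BalabanUVNodes.N12GaugeLetterLocAtRecordLocal (exists_gaugeLetterLoc_atRecord_local)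
open Summit.QuantumFields.YangMills.BalabanUVNodes.N12RootTransporterBj (theta_mono_of_nonneg)

/-! ## §1  The linear producer premise `hlin` from the forest-free capstone -/

/-- ★ **`hlin` FROM dag-n12-w3's CAPSTONE.**  At every guard `e ∈ (0, e₀]`, every base field `V_k` of the guard with extended datum `ρlin·e`-near `1` on the region box, and every (2.12)
minimiser `U₀`: `exists_gaugeLetterLoc_atRecord` at `W := ext V_k`, `𝒞 := boxBonds LO HI`, `ρn := ρlin·e`, `εP := cP·e`, budgets `a e`, `θ e`, `δ₁ := cδ·e`, followed by
`max ρn (C₁·εP + m·θ e k + m·δ₁) ≤ (ρlin + C₁·cP + m·cθ + m·cδ)·e`. [cite: Balaban1985Variational, (3)–(4) p.278, Thm 1 (8) p.279, (16)–(18) p.280; Balaban1988Convergent, (2.2) p.255, (2.12)–(2.13) pp.256–257,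
(2.16) p.257; Balaban1989LargeFieldI, Prop. 1 p.194 («for ε > 0 sufficiently small»)] -/
theorem hlin_of_gaugeLetterLocAtRecord_linear_local {F : T4Family} (ν : Node00.Stage7Numerics) (Kt : ℕ) {k : ℕ} (hk0 : 0 < k) (hk : k ≤ (F.P Kt).m + (F.P Kt).K)
    (hM2 : 2 ≤ ν.M₁) (hdiv : side (F.P Kt).L ν.M₁ k ∣ (F.P Kt).sitesPerDir 0) (Z : Set (Site (F.P Kt) 0))
    -- no wrapping, at the caps `ℓ_k`, `m·L^k`
    (hN : 2 * (∑ i ∈ Finset.range (k + 1), ((F.P Kt).d * (((F.P Kt).L ^ i - 1) / 2) + 1)) + 1 +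
      (3 * ((F.P Kt).d * (((F.P Kt).L - 1) / 2)) + 5) * (F.P Kt).L ^ k < (F.P Kt).sitesPerDir 0)
    -- the socket's objects: the base fields' extension `ext`, the complement box `Λ`, the region box `[LO, HI]` with sizes `n n'` (datum tolerance `ρlin·e`, the endpoints' `hρn` text)
    (Λ : Set (Site (F.P Kt) 0)) (ext : GaugeField (F.P Kt) k SU2 → GaugeField (F.P Kt) k SU2) (LO HI : Fin (F.P Kt).d → ℤ) (n n' : ℕ)
    -- geometry of the neighbourhood (dag-n12-w6's letters; (gN1) at the region box)
    (N : Set (PBond (F.P Kt) 0))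
    (hGN : ∀ b ∈ N, (b.src ∉ maxDomT ν.M₁ Z 1 ∨ b.tgt ∉ maxDomT ν.M₁ Z 1) → blockIter k b.tgt ≠ blockIter k b.src →
      (⟨blockIter k b.src, b.dir⟩ : PBond (F.P Kt) k) ∈ (boxBonds LO HI : Set (PBond (F.P Kt) k)))
    (hN1 : ∀ p : Plaq (F.P Kt) 0, ((⟨p.src, p.μ⟩ : PBond (F.P Kt) 0) ∈ {b : PBond (F.P Kt) 0 | b.src ∈ maxDomT ν.M₁ Z 1} ∨
        (⟨p.src.shift p.μ, p.ν⟩ : PBond (F.P Kt) 0) ∈ {b : PBond (F.P Kt) 0 | b.src ∈ maxDomT ν.M₁ Z 1} ∨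
        (⟨p.src.shift p.ν, p.μ⟩ : PBond (F.P Kt) 0) ∈ {b : PBond (F.P Kt) 0 | b.src ∈ maxDomT ν.M₁ Z 1} ∨
        (⟨p.src, p.ν⟩ : PBond (F.P Kt) 0) ∈ {b : PBond (F.P Kt) 0 | b.src ∈ maxDomT ν.M₁ Z 1}) →
      (⟨p.src, p.μ⟩ : PBond (F.P Kt) 0) ∈ N ∧ (⟨p.src.shift p.μ, p.ν⟩ : PBond (F.P Kt) 0) ∈ N ∧
        (⟨p.src.shift p.ν, p.μ⟩ : PBond (F.P Kt) 0) ∈ N ∧ (⟨p.src, p.ν⟩ : PBond (F.P Kt) 0) ∈ N)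
    -- the reference guard and the LINEAR moduli of the three displayed letters
    {e₀ cP cθ cδ : ℝ} (hcP : 0 ≤ cP) (hcδ : 0 ≤ cδ)
    -- DISPLAYED, LINEAR IN THE GUARD: ONE graded root-free plaquette letter for the minimiser ((1.7) ∕ [15] Thm 1), boxes in LEVEL FORM inside `S`
    {S : Set (Plaq (F.P Kt) 0)}
    (hP : ∀ e : ℝ, 0 < e → e ≤ e₀ → ∀ (Vk : GaugeField (F.P Kt) k SU2), PlaqSmallOn (plaqsInside (pts k (Z ∩ Λᶜ))) e Vk →
      (∀ b ∈ (boxBonds LO HI : Set (PBond (F.P Kt) k)), dist1 (ext Vk b) ≤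
        (((F.P Kt).d : ℝ) * n' + 1) * ((((F.P Kt).d - 1 : ℕ) : ℝ) * n' * ((12 * (F.P Kt).d * (n + 2) ^ 2 + 1) * e) + 3 * (F.P Kt).d * (n + 2) ^ 2 * e)) →
      ∀ U₀ : GaugeField (F.P Kt) 0 SU2,
        IsMinimizer (Node00.avOfRecord F 2 Kt) (Node00.regMSCoPOfRecord F 2 ν Kt k (maxDomT ν.M₁ Z)) (Bj ν.M₁ Z k)
          (avgFamily (Node00.avOfRecord F 2 Kt) (qsstarGIter0 k (ext Vk))) U₀ →
        PlaqSmallOn S (cP * e) U₀)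
    (hSΩ : ∀ b : PBond (F.P Kt) 0, b.src ∈ maxDomT ν.M₁ Z 1 → b.tgt ∈ maxDomT ν.M₁ Z 1 →
      ∀ J J' : ℕ, iterBlockOf J b.src ∈ (Bj ν.M₁ Z k : DetSet (F.P Kt)) J → iterBlockOf J' b.tgt ∈ (Bj ν.M₁ Z k : DetSet (F.P Kt)) J' →
      (boxPlaqs
          (fun κ => ((b.src κ).val : ℤ) -
            (((2 * max (∑ i ∈ Finset.range (J + 1), ((F.P Kt).d * (((F.P Kt).L ^ i - 1) / 2) + 1))
                  (∑ i ∈ Finset.range (J' + 1), ((F.P Kt).d * (((F.P Kt).L ^ i - 1) / 2) + 1)) + 1 +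
                (3 * ((F.P Kt).d * (((F.P Kt).L - 1) / 2)) + 5) * (F.P Kt).L ^ min (J + 1) k) +
              ∑ i ∈ Finset.range (J + 1), ((F.P Kt).d * (((F.P Kt).L ^ i - 1) / 2) + 1) : ℕ) : ℤ))
          (fun κ => ((b.src κ).val : ℤ) +
            (((2 * max (∑ i ∈ Finset.range (J + 1), ((F.P Kt).d * (((F.P Kt).L ^ i - 1) / 2) + 1))
                  (∑ i ∈ Finset.range (J' + 1), ((F.P Kt).d * (((F.P Kt).L ^ i - 1) / 2) + 1)) + 1 +
                (3 * ((F.P Kt).d * (((F.P Kt).L - 1) / 2)) + 5) * (F.P Kt).L ^ min (J + 1) k) +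
              ∑ i ∈ Finset.range (J + 1), ((F.P Kt).d * (((F.P Kt).L ^ i - 1) / 2) + 1) : ℕ) : ℤ) + 2) : Set (Plaq (F.P Kt) 0)) ⊆ S)
    -- DISPLAYED, GUARD-INDEXED: the plaquette letter on the iterated averages of the minimiser near the member segments, with its budgets `a e`, `θ e` (per guard `e`) and a LINEAR cap on `θ e k`
    (a θ : ℝ → ℕ → ℝ) (hθ0 : ∀ e, 0 ≤ θ e 0) (ha0 : ∀ e j, 0 ≤ a e j)
    (haN : ∀ e : ℝ, 0 < e → e ≤ e₀ → ∀ j < k, (((((F.P Kt).d + 2) * (F.P Kt).L : ℕ) : ℝ) ^ 2 / 4) * a e j < deltaSU (Fin 2))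
    (hθ : ∀ e j, 6 * ((((((F.P Kt).d + 2) * (F.P Kt).L : ℕ) : ℝ) ^ 2 / 4) * a e j) + (F.P Kt).L * θ e j ≤ θ e (j + 1))
    (hθk : ∀ e : ℝ, 0 < e → e ≤ e₀ → θ e k ≤ cθ * e)
    (ha : ∀ e : ℝ, 0 < e → e ≤ e₀ → ∀ (Vk : GaugeField (F.P Kt) k SU2), PlaqSmallOn (plaqsInside (pts k (Z ∩ Λᶜ))) e Vk →
      (∀ b ∈ (boxBonds LO HI : Set (PBond (F.P Kt) k)), dist1 (ext Vk b) ≤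
        (((F.P Kt).d : ℝ) * n' + 1) * ((((F.P Kt).d - 1 : ℕ) : ℝ) * n' * ((12 * (F.P Kt).d * (n + 2) ^ 2 + 1) * e) + 3 * (F.P Kt).d * (n + 2) ^ 2 * e)) →
      ∀ U₀ : GaugeField (F.P Kt) 0 SU2,
        IsMinimizer (Node00.avOfRecord F 2 Kt) (Node00.regMSCoPOfRecord F 2 ν Kt k (maxDomT ν.M₁ Z)) (Bj ν.M₁ Z k)
          (avgFamily (Node00.avOfRecord F 2 Kt) (qsstarGIter0 k (ext Vk))) U₀ →
      ∀ i ≤ k, ∀ c ∈ bondsOf ((Bj ν.M₁ Z k : DetSet (F.P Kt)) i), ∀ j < i, ∀ c' : PBond (F.P Kt) (j + 1), c'.dir = c.dir →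
      (∃ s < (F.P Kt).L ^ i, embIter (j + 1) c'.src = (fun z : Site (F.P Kt) 0 => z.shift c.dir)^[s] (embIter i c.src)) →
      ∀ q : Plaq (F.P Kt) j, (blockOf q.src = c'.src.unshift c'.dir ∨ blockOf q.src = c'.src ∨ blockOf q.src = c'.tgt) →
        dist1 (GaugeField.plaqHol (avgFamily (Node00.avOfRecord F 2 Kt) U₀ j) q) < a e j)
    -- DISPLAYED, LINEAR IN THE GUARD: the datum letter at the members (levels `≤ k`) for every guarded base field
    (hWj : ∀ e : ℝ, 0 < e → e ≤ e₀ → ∀ (Vk : GaugeField (F.P Kt) k SU2), PlaqSmallOn (plaqsInside (pts k (Z ∩ Λᶜ))) e Vk →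
      (∀ b ∈ (boxBonds LO HI : Set (PBond (F.P Kt) k)), dist1 (ext Vk b) ≤
        (((F.P Kt).d : ℝ) * n' + 1) * ((((F.P Kt).d - 1 : ℕ) : ℝ) * n' * ((12 * (F.P Kt).d * (n + 2) ^ 2 + 1) * e) + 3 * (F.P Kt).d * (n + 2) ^ 2 * e)) →
      ∀ x ∈ maxDomT ν.M₁ Z 1, ∀ i ≤ k, ∀ c ∈ bondsOf ((Bj ν.M₁ Z k : DetSet (F.P Kt)) i),
        (∃ w : List (Letter (F.P Kt).d), w.length ≤ (∑ i ∈ Finset.range (k + 1), ((F.P Kt).d * (((F.P Kt).L ^ i - 1) / 2) + 1)) + (3 * ((F.P Kt).d * (((F.P Kt).L - 1) / 2)) + 5) * (F.P Kt).L ^ k ∧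
          (walkEnd x w = embIter i c.src ∨ walkEnd x w = embIter i c.tgt)) →
        dist1 (avgFamily (Node00.avOfRecord F 2 Kt) (qsstarGIter0 k (ext Vk)) i c) ≤ cδ * e) :
    ∀ e : ℝ, 0 < e → e ≤ e₀ → ∀ (Vk : GaugeField (F.P Kt) k SU2), PlaqSmallOn (plaqsInside (pts k (Z ∩ Λᶜ))) e Vk →
      (∀ b ∈ (boxBonds LO HI : Set (PBond (F.P Kt) k)), dist1 (ext Vk b) ≤
        (((F.P Kt).d : ℝ) * n' + 1) * ((((F.P Kt).d - 1 : ℕ) : ℝ) * n' * ((12 * (F.P Kt).d * (n + 2) ^ 2 + 1) * e) + 3 * (F.P Kt).d * (n + 2) ^ 2 * e)) →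
      ∀ U₀ : GaugeField (F.P Kt) 0 SU2,
        IsMinimizer (Node00.avOfRecord F 2 Kt) (Node00.regMSCoPOfRecord F 2 ν Kt k (maxDomT ν.M₁ Z)) (Bj ν.M₁ Z k)
          (avgFamily (Node00.avOfRecord F 2 Kt) (qsstarGIter0 k (ext Vk))) U₀ →
        ∃ σ : GaugeTransf (F.P Kt) 0 SU2,
          (∀ j, j ≤ k → ∀ b ∈ bondsOf (Bj ν.M₁ Z k j), toMS σ j b.src = 1 ∧ toMS σ j b.tgt = 1) ∧
            (∀ p : Plaq (F.P Kt) 0, ((⟨p.src, p.μ⟩ : PBond (F.P Kt) 0) ∈ {b : PBond (F.P Kt) 0 | b.src ∈ maxDomT ν.M₁ Z 1} ∨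
                (⟨p.src.shift p.μ, p.ν⟩ : PBond (F.P Kt) 0) ∈ {b : PBond (F.P Kt) 0 | b.src ∈ maxDomT ν.M₁ Z 1} ∨
                (⟨p.src.shift p.ν, p.μ⟩ : PBond (F.P Kt) 0) ∈ {b : PBond (F.P Kt) 0 | b.src ∈ maxDomT ν.M₁ Z 1} ∨
                (⟨p.src, p.ν⟩ : PBond (F.P Kt) 0) ∈ {b : PBond (F.P Kt) 0 | b.src ∈ maxDomT ν.M₁ Z 1}) →
              ‖((gaugeAct σ U₀ ⟨p.src, p.μ⟩ : SU2) : Matrix (Fin 2) (Fin 2) ℂ) - 1‖ ≤ (((((F.P Kt).d : ℝ) * n' + 1) * ((((F.P Kt).d - 1 : ℕ) : ℝ) * n' * (12 * (F.P Kt).d * (n + 2) ^ 2 + 1) + 3 * (F.P Kt).d * (n + 2) ^ 2)) + (((2 * (∑ i ∈ Finset.range (k + 1), ((F.P Kt).d * (((F.P Kt).L ^ i - 1) / 2) + 1)) + 1 + (3 * ((F.P Kt).d * (((F.P Kt).L - 1) / 2)) + 5) * (F.P Kt).L ^ k : ℕ) : ℝ)) ^ 2 / 4 * cP + ((3 * ((F.P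 Kt).d * (((F.P Kt).L - 1) / 2)) + 5 : ℕ) : ℝ) * cθ + ((3 * ((F.P Kt).d * (((F.P Kt).L - 1) / 2)) + 5 : ℕ) : ℝ) * cδ) * e ∧ ‖((gaugeAct σ U₀ ⟨p.src.shift p.μ, p.ν⟩ : SU2) : Matrix (Fin 2) (Fin 2) ℂ) - 1‖ ≤ (((((F.P Kt).d : ℝ) * n' + 1) * ((((F.P Kt).d - 1 : ℕ) : ℝ) * n' * (12 * (F.P Kt).d * (n + 2) ^ 2 + 1) + 3 * (F.P Kt).d * (n + 2) ^ 2)) + (((2 * (∑ i ∈ Finset.range (k + 1), ((F.P Kt).d * (((F.P Kt).L ^ i - 1) / 2) + 1)) + 1 + (3 * ((F.P Kt).d * (((F.P Kt).L - 1) / 2)) + 5) * (F.P Kt).L ^ k : ℕ) : ℝ)) ^ 2 / 4 * cP + ((3 * ((F.P Kt).d * (((F.P Kt).L - 1) / 2)) + 5 : ℕ) : ℝ) * cθ + ((3 * ((F.P Kt).d * (((F.P Kt).L - 1) / 2)) + 5 : ℕ) : ℝ) * cδ) * e ∧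
                ‖((gaugeAct σ U₀ ⟨p.src.shift p.ν, p.μ⟩ : SU2) : Matrix (Fin 2) (Fin 2) ℂ) - 1‖ ≤ (((((F.P Kt).d : ℝ) * n' + 1) * ((((F.P Kt).d - 1 : ℕ) : ℝ) * n' * (12 * (F.P Kt).d * (n + 2) ^ 2 + 1) + 3 * (F.P Kt).d * (n + 2) ^ 2)) + (((2 * (∑ i ∈ Finset.range (k + 1), ((F.P Kt).d * (((F.P Kt).L ^ i - 1) / 2) + 1)) + 1 + (3 * ((F.P Kt).d * (((F.P Kt).L - 1) / 2)) + 5) * (F.P Kt).L ^ k : ℕ) : ℝ)) ^ 2 / 4 * cP + ((3 * ((F.P Kt).d * (((F.P Kt).L - 1) / 2)) + 5 : ℕ) : ℝ) * cθ + ((3 * ((F.P Kt).d * (((F.P Kt).L - 1) / 2)) + 5 : ℕ) : ℝ) * cδ) * e ∧ ‖((gaugeAct σ U₀ ⟨p.src, p.ν⟩ : SU2) : Matrix (Fin 2) (Fin 2) ℂ) - 1‖ ≤ (((((F.P Kt).d : ℝ) * n' + 1) * ((((F.P Kt).d - 1 : ℕ) : ℝ) * n' * (12 * (F.P Kt).d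 * (n + 2) ^ 2 + 1) + 3 * (F.P Kt).d * (n + 2) ^ 2)) + (((2 * (∑ i ∈ Finset.range (k + 1), ((F.P Kt).d * (((F.P Kt).L ^ i - 1) / 2) + 1)) + 1 + (3 * ((F.P Kt).d * (((F.P Kt).L - 1) / 2)) + 5) * (F.P Kt).L ^ k : ℕ) : ℝ)) ^ 2 / 4 * cP + ((3 * ((F.P Kt).d * (((F.P Kt).L - 1) / 2)) + 5 : ℕ) : ℝ) * cθ + ((3 * ((F.P Kt).d * (((F.P Kt).L - 1) / 2)) + 5 : ℕ) : ℝ) * cδ) * e) ∧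
          (∀ b ∈ inputs (Bj ν.M₁ Z k), b ∈ N → ‖((gaugeAct σ U₀ b : SU2) : Matrix (Fin 2) (Fin 2) ℂ) - 1‖ ≤ (((((F.P Kt).d : ℝ) * n' + 1) * ((((F.P Kt).d - 1 : ℕ) : ℝ) * n' * (12 * (F.P Kt).d * (n + 2) ^ 2 + 1) + 3 * (F.P Kt).d * (n + 2) ^ 2)) + (((2 * (∑ i ∈ Finset.range (k + 1), ((F.P Kt).d * (((F.P Kt).L ^ i - 1) / 2) + 1)) + 1 + (3 * ((F.P Kt).d * (((F.P Kt).L - 1) / 2)) + 5) * (F.P Kt).L ^ k : ℕ) : ℝ)) ^ 2 / 4 * cP + ((3 * ((F.P Kt).d * (((F.P Kt).L - 1) / 2)) + 5 : ℕ) : ℝ) * cθ + ((3 * ((F.P Kt).d * (((F.P Kt).L - 1) / 2)) + 5 : ℕ) : ℝ) * cδ) * e) := by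
  intro e he hee₀ Vk hV hD U₀ hU₀
  have hρn : (0 : ℝ) ≤ (((F.P Kt).d : ℝ) * n' + 1) * ((((F.P Kt).d - 1 : ℕ) : ℝ) * n' * ((12 * (F.P Kt).d * (n + 2) ^ 2 + 1) * e) + 3 * (F.P Kt).d * (n + 2) ^ 2 * e) := by positivity
  have hm0 : (0 : ℝ) ≤ ((3 * ((F.P Kt).d * (((F.P Kt).L - 1) / 2)) + 5 : ℕ) : ℝ) := Nat.cast_nonneg _
  have hθk0 : 0 ≤ θ e k := by
    have hκ0 : ∀ j, 0 ≤ 6 * ((((((F.P Kt).d + 2) * (F.P Kt).L : ℕ) : ℝ) ^ 2 / 4) * a e j) := fun j => by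
      have h1 : (0 : ℝ) ≤ (((((F.P Kt).d + 2) * (F.P Kt).L : ℕ) : ℝ) ^ 2 / 4) := by positivity
      nlinarith [mul_nonneg h1 (ha0 e j)]
    exact (hθ0 e).trans (theta_mono_of_nonneg _ (θ e) (hθ0 e) hκ0 (hθ e) (Nat.zero_le k)).2
  have hcθ0 : 0 ≤ cθ * e := hθk0.trans (hθk e he hee₀)
  obtain ⟨σ, hu, hC1, hCin⟩ := exists_gaugeLetterLoc_atRecord_local ν Kt hk0 hk hM2 hdiv Z hN hρn (ext Vk) (boxBonds LO HI : Set (PBond (F.P Kt) k)) hD hU₀ N hGN hN1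
    (mul_nonneg hcP he.le) (hP e he hee₀ Vk hV hD U₀ hU₀) hSΩ (a e) (θ e) (hθ0 e) (ha0 e) (haN e he hee₀) (hθ e) (ha e he hee₀ Vk hV hD U₀ hU₀)
    (mul_nonneg hcδ he.le) (hWj e he hee₀ Vk hV hD)
  -- the assembled tolerance is below the linear modulus
  have hle : max ((((F.P Kt).d : ℝ) * n' + 1) * ((((F.P Kt).d - 1 : ℕ) : ℝ) * n' * ((12 * (F.P Kt).d * (n + 2) ^ 2 + 1) * e) + 3 * (F.P Kt).d * (n + 2) ^ 2 * e)) ((((2 * (∑ i ∈ Finset.range (k + 1), ((F.P Kt).d * (((F.P Kt).L ^ i - 1) / 2) + 1)) + 1 +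
                  (3 * ((F.P Kt).d * (((F.P Kt).L - 1) / 2)) + 5) * (F.P Kt).L ^ k : ℕ) : ℝ)) ^ 2 / 4 * (cP * e) +
                ((3 * ((F.P Kt).d * (((F.P Kt).L - 1) / 2)) + 5 : ℕ) : ℝ) * θ e k + ((3 * ((F.P Kt).d * (((F.P Kt).L - 1) / 2)) + 5 : ℕ) : ℝ) * (cδ * e)) ≤ (((((F.P Kt).d : ℝ) * n' + 1) * ((((F.P Kt).d - 1 : ℕ) : ℝ) * n' * (12 * (F.P Kt).d * (n + 2) ^ 2 + 1) + 3 * (F.P Kt).d * (n + 2) ^ 2)) + (((2 * (∑ i ∈ Finset.range (k + 1), ((F.P Kt).d * (((F.P Kt).L ^ i - 1) / 2) + 1)) + 1 + (3 * ((F.P Kt).d * (((F.P Kt).L - 1) / 2)) + 5) * (F.P Kt).L ^ k : ℕ) : ℝ)) ^ 2 / 4 * cP + ((3 * ((F.P Kt).d * (((F.P Kt).L - 1) / 2)) + 5 : ℕ) : ℝ) * cθ + ((3 * ((F.P Kt).d * (((F.P Kt).L - 1) / 2)) + 5 : ℕ) : ℝ) * cδ) * e := by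
    have key : (((F.P Kt).d : ℝ) * n' + 1) * ((((F.P Kt).d - 1 : ℕ) : ℝ) * n' * ((12 * (F.P Kt).d * (n + 2) ^ 2 + 1) * e) + 3 * (F.P Kt).d * (n + 2) ^ 2 * e) = ((((F.P Kt).d : ℝ) * n' + 1) * ((((F.P Kt).d - 1 : ℕ) : ℝ) * n' * (12 * (F.P Kt).d * (n + 2) ^ 2 + 1) + 3 * (F.P Kt).d * (n + 2) ^ 2)) * e := by ring
    have h1 : (0 : ℝ) ≤ (((2 * (∑ i ∈ Finset.range (k + 1), ((F.P Kt).d * (((F.P Kt).L ^ i - 1) / 2) + 1)) + 1 + (3 * ((F.P Kt).d * (((F.P Kt).L - 1) / 2)) + 5) * (F.P Kt).L ^ k : ℕ) : ℝ)) ^ 2 / 4 * (cP * e) := by positivity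
    have h2 : ((3 * ((F.P Kt).d * (((F.P Kt).L - 1) / 2)) + 5 : ℕ) : ℝ) * θ e k ≤ ((3 * ((F.P Kt).d * (((F.P Kt).L - 1) / 2)) + 5 : ℕ) : ℝ) * (cθ * e) := mul_le_mul_of_nonneg_left (hθk e he hee₀) hm0
    have h3 : (0 : ℝ) ≤ ((3 * ((F.P Kt).d * (((F.P Kt).L - 1) / 2)) + 5 : ℕ) : ℝ) * (cδ * e) := mul_nonneg hm0 (mul_nonneg hcδ he.le)
    have h4 : (0 : ℝ) ≤ ((((F.P Kt).d : ℝ) * n' + 1) * ((((F.P Kt).d - 1 : ℕ) : ℝ) * n' * (12 * (F.P Kt).d * (n + 2) ^ 2 + 1) + 3 * (F.P Kt).d * (n + 2) ^ 2)) * e := by positivity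
    rw [key]
    refine max_le ?_ ?_ <;> nlinarith
  refine ⟨σ, hu, fun p hp => ?_, fun b hb hbN => (hCin b hb hbN).trans hle⟩
  obtain ⟨h₁, h₂, h₃, h₄⟩ := hC1 p hp
  exact ⟨h₁.trans hle, h₂.trans hle, h₃.trans hle, h₄.trans hle⟩

/-! ## §2  The ∀δ∃e socket of the assembled endpoints, from the capstone -/

/-- ★★ **THE `hσN` SOCKET OF `…AssembledOfGaugeLetterAtToleranceLoc(OfChartLetterN)` FROM dag-n12-w3's CAPSTONE AND THE THREE LINEAR LETTERS** — §1 followed by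
`forall_target_exists_guard_of_linear` (`0 ≤ cθ` follows from the cap at the reference guard).  The knit writes, per instance, `hσN := fun i => hσN_of_gaugeLetterLocAtRecord_linear …`.
[cite: Balaban1989LargeFieldI, Prop. 1 p.194 («for ε > 0 sufficiently small»); Balaban1985Variational, (4) p.278, Thm 1 (8) p.279, (16)–(18) p.280; Balaban1988Convergent, (2.2) p.255, (2.12)–(2.13) pp.256–257] -/
theorem hσN_of_gaugeLetterLocAtRecord_linear_local {F : T4Family} (ν : Node00.Stage7Numerics) (Kt : ℕ) {k : ℕ} (hk0 : 0 < k) (hk : k ≤ (F.P Kt).m + (F.P Kt).K)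
    (hM2 : 2 ≤ ν.M₁) (hdiv : side (F.P Kt).L ν.M₁ k ∣ (F.P Kt).sitesPerDir 0) (Z : Set (Site (F.P Kt) 0))
    -- no wrapping, at the caps `ℓ_k`, `m·L^k`
    (hN : 2 * (∑ i ∈ Finset.range (k + 1), ((F.P Kt).d * (((F.P Kt).L ^ i - 1) / 2) + 1)) + 1 +
      (3 * ((F.P Kt).d * (((F.P Kt).L - 1) / 2)) + 5) * (F.P Kt).L ^ k < (F.P Kt).sitesPerDir 0)
    -- the socket's objects: the base fields' extension `ext`, the complement box `Λ`, the region box `[LO, HI]` with sizes `n n'` (datum tolerance `ρlin·e`, the endpoints' `hρn` text)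
    (Λ : Set (Site (F.P Kt) 0)) (ext : GaugeField (F.P Kt) k SU2 → GaugeField (F.P Kt) k SU2) (LO HI : Fin (F.P Kt).d → ℤ) (n n' : ℕ)
    -- geometry of the neighbourhood (dag-n12-w6's letters; (gN1) at the region box)
    (N : Set (PBond (F.P Kt) 0))
    (hGN : ∀ b ∈ N, (b.src ∉ maxDomT ν.M₁ Z 1 ∨ b.tgt ∉ maxDomT ν.M₁ Z 1) → blockIter k b.tgt ≠ blockIter k b.src →
      (⟨blockIter k b.src, b.dir⟩ : PBond (F.P Kt) k) ∈ (boxBonds LO HI : Set (PBond (F.P Kt) k)))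
    (hN1 : ∀ p : Plaq (F.P Kt) 0, ((⟨p.src, p.μ⟩ : PBond (F.P Kt) 0) ∈ {b : PBond (F.P Kt) 0 | b.src ∈ maxDomT ν.M₁ Z 1} ∨
        (⟨p.src.shift p.μ, p.ν⟩ : PBond (F.P Kt) 0) ∈ {b : PBond (F.P Kt) 0 | b.src ∈ maxDomT ν.M₁ Z 1} ∨
        (⟨p.src.shift p.ν, p.μ⟩ : PBond (F.P Kt) 0) ∈ {b : PBond (F.P Kt) 0 | b.src ∈ maxDomT ν.M₁ Z 1} ∨
        (⟨p.src, p.ν⟩ : PBond (F.P Kt) 0) ∈ {b : PBond (F.P Kt) 0 | b.src ∈ maxDomT ν.M₁ Z 1}) →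
      (⟨p.src, p.μ⟩ : PBond (F.P Kt) 0) ∈ N ∧ (⟨p.src.shift p.μ, p.ν⟩ : PBond (F.P Kt) 0) ∈ N ∧
        (⟨p.src.shift p.ν, p.μ⟩ : PBond (F.P Kt) 0) ∈ N ∧ (⟨p.src, p.ν⟩ : PBond (F.P Kt) 0) ∈ N)
    -- the reference guard and the LINEAR moduli of the three displayed letters
    {e₀ cP cθ cδ : ℝ} (he₀ : 0 < e₀) (hcP : 0 ≤ cP) (hcδ : 0 ≤ cδ)
    -- DISPLAYED, LINEAR IN THE GUARD: ONE graded root-free plaquette letter for the minimiser ((1.7) ∕ [15] Thm 1), boxes in LEVEL FORM inside `S`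
    {S : Set (Plaq (F.P Kt) 0)}
    (hP : ∀ e : ℝ, 0 < e → e ≤ e₀ → ∀ (Vk : GaugeField (F.P Kt) k SU2), PlaqSmallOn (plaqsInside (pts k (Z ∩ Λᶜ))) e Vk →
      (∀ b ∈ (boxBonds LO HI : Set (PBond (F.P Kt) k)), dist1 (ext Vk b) ≤
        (((F.P Kt).d : ℝ) * n' + 1) * ((((F.P Kt).d - 1 : ℕ) : ℝ) * n' * ((12 * (F.P Kt).d * (n + 2) ^ 2 + 1) * e) + 3 * (F.P Kt).d * (n + 2) ^ 2 * e)) →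
      ∀ U₀ : GaugeField (F.P Kt) 0 SU2,
        IsMinimizer (Node00.avOfRecord F 2 Kt) (Node00.regMSCoPOfRecord F 2 ν Kt k (maxDomT ν.M₁ Z)) (Bj ν.M₁ Z k)
          (avgFamily (Node00.avOfRecord F 2 Kt) (qsstarGIter0 k (ext Vk))) U₀ →
        PlaqSmallOn S (cP * e) U₀)
    (hSΩ : ∀ b : PBond (F.P Kt) 0, b.src ∈ maxDomT ν.M₁ Z 1 → b.tgt ∈ maxDomT ν.M₁ Z 1 →
      ∀ J J' : ℕ, iterBlockOf J b.src ∈ (Bj ν.M₁ Z k : DetSet (F.P Kt)) J → iterBlockOf J' b.tgt ∈ (Bj ν.M₁ Z k : DetSet (F.P Kt)) J' →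
      (boxPlaqs
          (fun κ => ((b.src κ).val : ℤ) -
            (((2 * max (∑ i ∈ Finset.range (J + 1), ((F.P Kt).d * (((F.P Kt).L ^ i - 1) / 2) + 1))
                  (∑ i ∈ Finset.range (J' + 1), ((F.P Kt).d * (((F.P Kt).L ^ i - 1) / 2) + 1)) + 1 +
                (3 * ((F.P Kt).d * (((F.P Kt).L - 1) / 2)) + 5) * (F.P Kt).L ^ min (J + 1) k) +
              ∑ i ∈ Finset.range (J + 1), ((F.P Kt).d * (((F.P Kt).L ^ i - 1) / 2) + 1) : ℕ) : ℤ))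
          (fun κ => ((b.src κ).val : ℤ) +
            (((2 * max (∑ i ∈ Finset.range (J + 1), ((F.P Kt).d * (((F.P Kt).L ^ i - 1) / 2) + 1))
                  (∑ i ∈ Finset.range (J' + 1), ((F.P Kt).d * (((F.P Kt).L ^ i - 1) / 2) + 1)) + 1 +
                (3 * ((F.P Kt).d * (((F.P Kt).L - 1) / 2)) + 5) * (F.P Kt).L ^ min (J + 1) k) +
              ∑ i ∈ Finset.range (J + 1), ((F.P Kt).d * (((F.P Kt).L ^ i - 1) / 2) + 1) : ℕ) : ℤ) + 2) : Set (Plaq (F.P Kt) 0)) ⊆ S)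
    -- DISPLAYED, GUARD-INDEXED: the plaquette letter on the iterated averages of the minimiser near the member segments, with its budgets `a e`, `θ e` (per guard `e`) and a LINEAR cap on `θ e k`
    (a θ : ℝ → ℕ → ℝ) (hθ0 : ∀ e, 0 ≤ θ e 0) (ha0 : ∀ e j, 0 ≤ a e j)
    (haN : ∀ e : ℝ, 0 < e → e ≤ e₀ → ∀ j < k, (((((F.P Kt).d + 2) * (F.P Kt).L : ℕ) : ℝ) ^ 2 / 4) * a e j < deltaSU (Fin 2))
    (hθ : ∀ e j, 6 * ((((((F.P Kt).d + 2) * (F.P Kt).L : ℕ) : ℝ) ^ 2 / 4) * a e j) + (F.P Kt).L * θ e j ≤ θ e (j + 1))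
    (hθk : ∀ e : ℝ, 0 < e → e ≤ e₀ → θ e k ≤ cθ * e)
    (ha : ∀ e : ℝ, 0 < e → e ≤ e₀ → ∀ (Vk : GaugeField (F.P Kt) k SU2), PlaqSmallOn (plaqsInside (pts k (Z ∩ Λᶜ))) e Vk →
      (∀ b ∈ (boxBonds LO HI : Set (PBond (F.P Kt) k)), dist1 (ext Vk b) ≤
        (((F.P Kt).d : ℝ) * n' + 1) * ((((F.P Kt).d - 1 : ℕ) : ℝ) * n' * ((12 * (F.P Kt).d * (n + 2) ^ 2 + 1) * e) + 3 * (F.P Kt).d * (n + 2) ^ 2 * e)) →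
      ∀ U₀ : GaugeField (F.P Kt) 0 SU2,
        IsMinimizer (Node00.avOfRecord F 2 Kt) (Node00.regMSCoPOfRecord F 2 ν Kt k (maxDomT ν.M₁ Z)) (Bj ν.M₁ Z k)
          (avgFamily (Node00.avOfRecord F 2 Kt) (qsstarGIter0 k (ext Vk))) U₀ →
      ∀ i ≤ k, ∀ c ∈ bondsOf ((Bj ν.M₁ Z k : DetSet (F.P Kt)) i), ∀ j < i, ∀ c' : PBond (F.P Kt) (j + 1), c'.dir = c.dir →
      (∃ s < (F.P Kt).L ^ i, embIter (j + 1) c'.src = (fun z : Site (F.P Kt) 0 => z.shift c.dir)^[s] (embIter i c.src)) →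
      ∀ q : Plaq (F.P Kt) j, (blockOf q.src = c'.src.unshift c'.dir ∨ blockOf q.src = c'.src ∨ blockOf q.src = c'.tgt) →
        dist1 (GaugeField.plaqHol (avgFamily (Node00.avOfRecord F 2 Kt) U₀ j) q) < a e j)
    -- DISPLAYED, LINEAR IN THE GUARD: the datum letter at the members (levels `≤ k`) for every guarded base field
    (hWj : ∀ e : ℝ, 0 < e → e ≤ e₀ → ∀ (Vk : GaugeField (F.P Kt) k SU2), PlaqSmallOn (plaqsInside (pts k (Z ∩ Λᶜ))) e Vk →
      (∀ b ∈ (boxBonds LO HI : Set (PBond (F.P Kt) k)), dist1 (ext Vk b) ≤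
        (((F.P Kt).d : ℝ) * n' + 1) * ((((F.P Kt).d - 1 : ℕ) : ℝ) * n' * ((12 * (F.P Kt).d * (n + 2) ^ 2 + 1) * e) + 3 * (F.P Kt).d * (n + 2) ^ 2 * e)) →
      ∀ x ∈ maxDomT ν.M₁ Z 1, ∀ i ≤ k, ∀ c ∈ bondsOf ((Bj ν.M₁ Z k : DetSet (F.P Kt)) i),
        (∃ w : List (Letter (F.P Kt).d), w.length ≤ (∑ i ∈ Finset.range (k + 1), ((F.P Kt).d * (((F.P Kt).L ^ i - 1) / 2) + 1)) + (3 * ((F.P Kt).d * (((F.P Kt).L - 1) / 2)) + 5) * (F.P Kt).L ^ k ∧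
          (walkEnd x w = embIter i c.src ∨ walkEnd x w = embIter i c.tgt)) →
        dist1 (avgFamily (Node00.avOfRecord F 2 Kt) (qsstarGIter0 k (ext Vk)) i c) ≤ cδ * e) :
        ∀ δ : ℝ, 0 < δ → ∃ e : ℝ, 0 < e ∧ ∀ (Vk : GaugeField (F.P Kt) k SU2), PlaqSmallOn (plaqsInside (pts k (Z ∩ Λᶜ))) e Vk →
      (∀ b ∈ (boxBonds LO HI : Set (PBond (F.P Kt) k)), dist1 (ext Vk b) ≤
        (((F.P Kt).d : ℝ) * n' + 1) * ((((F.P Kt).d - 1 : ℕ) : ℝ) * n' * ((12 * (F.P Kt).d * (n + 2) ^ 2 + 1) * e) + 3 * (F.P Kt).d * (n + 2) ^ 2 * e)) →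
      ∀ U₀ : GaugeField (F.P Kt) 0 SU2,
        IsMinimizer (Node00.avOfRecord F 2 Kt) (Node00.regMSCoPOfRecord F 2 ν Kt k (maxDomT ν.M₁ Z)) (Bj ν.M₁ Z k)
          (avgFamily (Node00.avOfRecord F 2 Kt) (qsstarGIter0 k (ext Vk))) U₀ →
        ∃ σ : GaugeTransf (F.P Kt) 0 SU2,
          (∀ j, j ≤ k → ∀ b ∈ bondsOf (Bj ν.M₁ Z k j), toMS σ j b.src = 1 ∧ toMS σ j b.tgt = 1) ∧
            (∀ p : Plaq (F.P Kt) 0, ((⟨p.src, p.μ⟩ : PBond (F.P Kt) 0) ∈ {b : PBond (F.P Kt) 0 | b.src ∈ maxDomT ν.M₁ Z 1} ∨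
                (⟨p.src.shift p.μ, p.ν⟩ : PBond (F.P Kt) 0) ∈ {b : PBond (F.P Kt) 0 | b.src ∈ maxDomT ν.M₁ Z 1} ∨
                (⟨p.src.shift p.ν, p.μ⟩ : PBond (F.P Kt) 0) ∈ {b : PBond (F.P Kt) 0 | b.src ∈ maxDomT ν.M₁ Z 1} ∨
                (⟨p.src, p.ν⟩ : PBond (F.P Kt) 0) ∈ {b : PBond (F.P Kt) 0 | b.src ∈ maxDomT ν.M₁ Z 1}) →
              ‖((gaugeAct σ U₀ ⟨p.src, p.μ⟩ : SU2) : Matrix (Fin 2) (Fin 2) ℂ) - 1‖ ≤ δ ∧ ‖((gaugeAct σ U₀ ⟨p.src.shift p.μ, p.ν⟩ : SU2) : Matrix (Fin 2) (Fin 2) ℂ) - 1‖ ≤ δ ∧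
                ‖((gaugeAct σ U₀ ⟨p.src.shift p.ν, p.μ⟩ : SU2) : Matrix (Fin 2) (Fin 2) ℂ) - 1‖ ≤ δ ∧ ‖((gaugeAct σ U₀ ⟨p.src, p.ν⟩ : SU2) : Matrix (Fin 2) (Fin 2) ℂ) - 1‖ ≤ δ) ∧
          (∀ b ∈ inputs (Bj ν.M₁ Z k), b ∈ N → ‖((gaugeAct σ U₀ b : SU2) : Matrix (Fin 2) (Fin 2) ℂ) - 1‖ ≤ δ) := by
  have hm0 : (0 : ℝ) ≤ ((3 * ((F.P Kt).d * (((F.P Kt).L - 1) / 2)) + 5 : ℕ) : ℝ) := Nat.cast_nonneg _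
  have hcθ : 0 ≤ cθ := by
    -- from the cap at the reference guard: `0 ≤ θ e₀ k ≤ cθ·e₀`
    have hκ0 : ∀ j, 0 ≤ 6 * ((((((F.P Kt).d + 2) * (F.P Kt).L : ℕ) : ℝ) ^ 2 / 4) * a e₀ j) := fun j => by
      have h1 : (0 : ℝ) ≤ (((((F.P Kt).d + 2) * (F.P Kt).L : ℕ) : ℝ) ^ 2 / 4) := by positivity
      nlinarith [mul_nonneg h1 (ha0 e₀ j)]
    have hθk0 : 0 ≤ θ e₀ k := (hθ0 e₀).trans (theta_mono_of_nonneg _ (θ e₀) (hθ0 e₀) hκ0 (hθ e₀) (Nat.zero_le k)).2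
    have h := hθk0.trans (hθk e₀ he₀ le_rfl)
    nlinarith
  have hC : (0 : ℝ) ≤ (((((F.P Kt).d : ℝ) * n' + 1) * ((((F.P Kt).d - 1 : ℕ) : ℝ) * n' * (12 * (F.P Kt).d * (n + 2) ^ 2 + 1) + 3 * (F.P Kt).d * (n + 2) ^ 2)) + (((2 * (∑ i ∈ Finset.range (k + 1), ((F.P Kt).d * (((F.P Kt).L ^ i - 1) / 2) + 1)) + 1 + (3 * ((F.P Kt).d * (((F.P Kt).L - 1) / 2)) + 5) * (F.P Kt).L ^ k : ℕ) : ℝ)) ^ 2 / 4 * cP + ((3 * ((F.P Kt).d * (((F.P Kt).L - 1) / 2)) + 5 : ℕ) : ℝ) * cθ + ((3 * ((F.P Kt).d * (((F.P Kt).L - 1) / 2)) + 5 : ℕ) : ℝ) * cδ) := by positivity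
  exact forall_target_exists_guard_of_linear ν Kt Z Λ ext LO HI n n' N he₀ hC
    (hlin_of_gaugeLetterLocAtRecord_linear_local ν Kt hk0 hk hM2 hdiv Z hN Λ ext LO HI n n' N hGN hN1 hcP hcδ hP hSΩ a θ hθ0 ha0 haN hθ hθk ha hWj)

end Summit.QuantumFields.YangMills.BalabanUVNodes.N12GaugeLetterSocketAtRecordLocal

end
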